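import Mathlib
import HarnessLib
import Literature.AlgebraicGeometry.Ramification.InertiaNormalSylow
import Summits.ResolutionOfSingularities.ResolutionOfSingularities.Theorems.WildQuotientsWildQuotientResolutionPointBlowupRankOne

/-!
# Over a blown-up closed point of a threefold, a point whose blow-up coordinates leave the residue field is p-closed (crux `WildQuotients.WildQuotientResolution`)

Crux stmt-ResolutionOfSingularities-15640 (`WildQuotientResolution`), registered stub
`stub_phaseZeroHighDim`, move-game track (`…PointMove`, `…FlagStepPoint`, ✓`…PointBlowupRankOne`).
Second storey of memo `PHASE0-DIM3-TERMINATION.md` §1 («on a threefold, point moves create no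
curves of non-p-closed inertia; non-p-closed points over `z` are `κ(z)`-rational»). With the point
blow-up stalk package at `x` over `z` (`ι = π♯_x : R → S`, `𝔪_R S = (ι t)`, inertia `I` acting by
`τ`, `τ₁`): every `r ∈ 𝔪_R` has a unique BLOW-UP COORDINATE `e(r) ∈ S` with `ι r = e(r) · ι t`; the
map `r ↦ e(r) mod 𝔫_S` is `R`-semilinear `𝔪_R → κ(x)`, kills `𝔪_R²`, and its kernel is exactly the
hyperplane piece `W̃ = {r | ι r ∈ 𝔫_S · ι t}` of `FlagStepPoint`. Hence, when `𝔪_R` is generated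
by THREE elements (embedding dimension `≤ 3`: a closed point of a regular threefold) and SOME
blow-up coordinate `e(r₁)` has residue OUTSIDE the image of `κ(z) → κ(x)`, the image of
`𝔪/𝔪² → κ(x)` has `κ(z)`-rank `≥ 2` (it contains `1 = e(t)` and `e(r₁)`), so `W̃` has rank `≤ 1`
mod `𝔪²` (rank–nullity on `κ(z)³`) and `I` is p-closed by
✓`hasNormalSylow_of_pointBlowupStep_of_rank_le_one`. For a point `x` of the exceptional divisor
with `κ(x) ≠ κ(z)` — every NON-CLOSED point of `E_z`, i.e. every would-be NPC CURVE created by the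
point move, and every closed point with a residue extension — such an `r₁` exists among the
generators `cᵢ` of `𝔪_z` (the residues of the `cᵢ/t` generate the residue ring of the Rees chart
`𝒪_z[𝔪/t] ⊇ 𝔴 ↔ x`, tree `IsBlowup.exists_reesChart_stalk`); that last, chart-level step is NOT
in this file (memo §1, size M).

* `exists_coord` — the blow-up coordinate `e` with `e r * ι t = ι r` on `𝔪_R`, unique, additive and
  `R`-semilinear, `e t = 1`.
* `hasNormalSylow_of_pointBlowupStep_of_residue` — the theorem.

[OURS · crux stmt-ResolutionOfSingularities-15640 · helper toward `stub_phaseZeroHighDim`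
(threefold Phase 0: no NPC curves from point moves, `κ`-rationality of NPC towers); folklore local
algebra, counted 0; AI-level work, weaker than expert review.]
-/

-- single-problem summit: the doubled namespace component `ResolutionOfSingularities` is forced
set_option linter.dupNamespace false

open IsLocalRing Literature.AlgebraicGeometry.Ramification
open Summit.ResolutionOfSingularities.ResolutionOfSingularities.Theorems.WildQuotientResolution.PointBlowupRankOne

namespace Summit.ResolutionOfSingularities.ResolutionOfSingularities.Theorems.WildQuotientResolution.PointBlowupResidue

/-- **Blow-up coordinates.** If `ι : R → S` is injective into a domain, `t ≠ 0` and
`ι(𝔪_R) S = (ι t)`, there is `e : R → S` with `e r * ι t = ι r` for `r ∈ 𝔪_R`; such a value is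
unique, so `e` is additive and `R`-semilinear on `𝔪_R` and `e t = 1`. [folklore] -/
theorem exists_coord {R S : Type*} [CommRing R] [IsLocalRing R] [CommRing S] [IsDomain S]
    (ι : R →+* S) (hι : Function.Injective ι) (t : R) (ht : t ∈ maximalIdeal R) (ht0 : t ≠ 0)
    (hgen : Ideal.map ι (maximalIdeal R) = Ideal.span {ι t}) :
    ∃ e : R → S, (∀ r ∈ maximalIdeal R, e r * ι t = ι r) ∧
      (∀ r ∈ maximalIdeal R, ∀ s : S, s * ι t = ι r → e r = s) ∧
      (∀ r ∈ maximalIdeal R, ∀ r' ∈ maximalIdeal R, e (r + r') = e r + e r') ∧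
      (∀ (a : R), ∀ r ∈ maximalIdeal R, e (a * r) = ι a * e r) ∧ e t = 1 := by
  classical
  have hu0 : ι t ≠ 0 := fun h => ht0 (hι (by rw [map_zero]; exact h))
  have hex : ∀ r : R, ∃ a : S, r ∈ maximalIdeal R → a * ι t = ι r := fun r => by
    by_cases hr : r ∈ maximalIdeal R
    · obtain ⟨a, ha⟩ := Ideal.mem_span_singleton'.mp
        (show ι r ∈ Ideal.span {ι t} from hgen ▸ Ideal.mem_map_of_mem ι hr)
      exact ⟨a, fun _ => ha⟩
    · exact ⟨0, fun h => absurd h hr⟩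
  choose e he using hex
  have huniq : ∀ r ∈ maximalIdeal R, ∀ s : S, s * ι t = ι r → e r = s := fun r hr s hs =>
    mul_right_cancel₀ hu0 ((he r hr).trans hs.symm)
  refine ⟨e, he, huniq, fun r hr r' hr' => ?_, fun a r hr => ?_, ?_⟩
  · exact huniq _ (add_mem hr hr') _ (by rw [add_mul, he r hr, he r' hr', map_add])
  · exact huniq _ (Ideal.mul_mem_left _ a hr) _ (by rw [mul_assoc, he r hr, map_mul])
  · exact huniq t ht 1 (one_mul _)

set_option maxHeartbeats 400000 in
/-- **Point blow-up step on a threefold: a point with a blow-up coordinate of residue outside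
`κ(z)` is p-closed.** Let `(R, 𝔪, κ)` be a Noetherian local ring with `𝔪` generated by three
elements `x₀, x₁, x₂` and `(S, 𝔫)` a local domain, residue characteristics `p`; `ι : R → S` an
injective local homomorphism with `𝔪 S = (ι t)`, `t ∈ 𝔪`; `I` a finite group acting on `R`
faithfully by `τ` and on `S` by `τ₁`, compatibly and residue-trivially on `S`. Suppose some
`r₁ ∈ 𝔪` has blow-up coordinate `s` (`s · ι t = ι r₁`) whose residue class in `κ(S)` is NOT in
the image of `κ(R)`. Then `I` has a normal Sylow `p`-subgroup. Proof: `r ↦ e(r) mod 𝔫` induces a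
`κ`-linear map `φ : κ³ → κ(S)` (coefficients on `x₀,x₁,x₂`) whose kernel describes `W̃` modulo `𝔪²`
and whose image contains the `κ`-independent `1, e(r₁)`; rank–nullity gives `dim ker φ ≤ 1`, a
lift `r₀` of a spanning vector spans `W̃` mod `𝔪²`, and
✓`hasNormalSylow_of_pointBlowupStep_of_rank_le_one` concludes. [folklore] -/
theorem hasNormalSylow_of_pointBlowupStep_of_residue (p : ℕ) [Fact p.Prime]
    {R S : Type*} [CommRing R] [IsLocalRing R] [IsNoetherianRing R]
    [CommRing S] [IsLocalRing S] [IsDomain S]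
    [CharP (ResidueField R) p] [CharP (ResidueField S) p]
    (ι : R →+* S) [IsLocalHom ι] (hι : Function.Injective ι)
    (t : R) (ht : t ∈ maximalIdeal R)
    (hgen : Ideal.map ι (maximalIdeal R) = Ideal.span {ι t})
    {I : Type*} [Group I] [Finite I] (τ : I →* (R ≃+* R)) (τ₁ : I →* (S ≃+* S))
    (hτ : Function.Injective τ) (hcomp : ∀ (g : I) (r : R), ι (τ g r) = τ₁ g (ι r))
    (hres : ∀ (g : I) (s : S), τ₁ g s - s ∈ maximalIdeal S)
    (x : Fin 3 → R) (hx : Ideal.span (Set.range x) = maximalIdeal R)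
    (r₁ : R) (hr₁ : r₁ ∈ maximalIdeal R)
    (hr₁res : ∀ s : S, s * ι t = ι r₁ →
      residue S s ∉ Set.range (ResidueField.map ι)) :
    HasNormalSylow p I := by
  classical
  -- `t ≠ 0` (otherwise `s = 0` is a blow-up coordinate of `r₁` with residue `0 ∈ κ(R)`)
  have ht0 : t ≠ 0 := by
    intro h
    have h1 : ι r₁ ∈ Ideal.span {ι t} := hgen ▸ Ideal.mem_map_of_mem ι hr₁
    rw [h, map_zero, Ideal.span_singleton_zero, Ideal.mem_bot] at h1
    exact hr₁res 0 (by rw [zero_mul, h1]) ⟨0, by rw [map_zero, map_zero]⟩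
  obtain ⟨e, he, huniq, hadd, hsmul, het⟩ := exists_coord ι hι t ht ht0 hgen
  have hxm : ∀ i, x i ∈ maximalIdeal R := fun i => hx ▸ Ideal.subset_span ⟨i, rfl⟩
  -- `κ(S)` as a `κ(R)`-vector space
  letI : Algebra (ResidueField R) (ResidueField S) := (ResidueField.map ι).toAlgebra
  have halg : ∀ a : ResidueField R, algebraMap (ResidueField R) (ResidueField S) a =
      ResidueField.map ι a := fun _ => rfl
  -- the linear map `φ : κ³ → κ(S)`, `v ↦ Σ vᵢ · e(xᵢ)`
  let d : Fin 3 → ResidueField S := fun i => residue S (e (x i))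
  let φ : (Fin 3 → ResidueField R) →ₗ[ResidueField R] ResidueField S :=
    { toFun := fun v => ∑ i, algebraMap (ResidueField R) (ResidueField S) (v i) * d i
      map_add' := fun v w => by
        simp only [Pi.add_apply, map_add, add_mul, Finset.sum_add_distrib]
      map_smul' := fun c v => by
        simp only [Pi.smul_apply, smul_eq_mul, map_mul, RingHom.id_apply, Finset.mul_sum,
          Algebra.smul_def, mul_assoc] }
  have hφ : ∀ v : Fin 3 → ResidueField R,
      φ v = ∑ i, algebraMap (ResidueField R) (ResidueField S) (v i) * d i := fun _ => rfl
  -- compatibility: `residue (e (Σ bᵢ xᵢ)) = φ (residue ∘ b)`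
  have hlin : ∀ b : Fin 3 → R, (∑ i, b i * x i) ∈ maximalIdeal R := fun b =>
    Ideal.sum_mem _ fun i _ => Ideal.mul_mem_left _ _ (hxm i)
  have hesum : ∀ b : Fin 3 → R, e (∑ i, b i * x i) = ∑ i, ι (b i) * e (x i) := by
    intro b
    refine huniq _ (hlin b) _ ?_
    rw [Finset.sum_mul, map_sum]
    refine Finset.sum_congr rfl fun i _ => ?_
    rw [mul_assoc, he (x i) (hxm i), map_mul]
  have hcompat : ∀ b : Fin 3 → R,
      residue S (e (∑ i, b i * x i)) = φ (fun i => residue R (b i)) := by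
    intro b
    rw [hesum, map_sum, hφ]
    refine Finset.sum_congr rfl fun i _ => ?_
    rw [map_mul, halg, ResidueField.map_residue]
  -- every `r ∈ 𝔪` is `Σ bᵢ xᵢ`
  have hrepr : ∀ r ∈ maximalIdeal R, ∃ b : Fin 3 → R, (∑ i, b i * x i) = r := fun r hr =>
    Ideal.mem_span_range_iff_exists_fun.mp (hx ▸ hr)
  -- `1 ∈ range φ` and `residue (e r₁) ∈ range φ`, the latter outside `κ(R)`
  obtain ⟨bt, hbt⟩ := hrepr t ht
  have h1 : φ (fun i => residue R (bt i)) = 1 := by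
    rw [← hcompat, hbt, het, map_one]
  obtain ⟨b₁, hb₁⟩ := hrepr r₁ hr₁
  have hd₁ : φ (fun i => residue R (b₁ i)) = residue S (e r₁) := by rw [← hcompat, hb₁]
  have hd₁out : residue S (e r₁) ∉ Set.range (ResidueField.map ι) := hr₁res _ (he r₁ hr₁)
  -- `finrank (range φ) ≥ 2`
  haveI : FiniteDimensional (ResidueField R) (LinearMap.range φ) :=
    Module.Finite.range φ
  have hrange2 : ¬ Module.finrank (ResidueField R) (LinearMap.range φ) ≤ 1 := by
    intro hle
    obtain ⟨w, hw⟩ := finrank_le_one_iff.mp hle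
    obtain ⟨c₁, hc₁⟩ := hw ⟨1, ⟨_, h1⟩⟩
    obtain ⟨c₂, hc₂⟩ := hw ⟨residue S (e r₁), ⟨_, hd₁⟩⟩
    have hc₁' : c₁ • (w : ResidueField S) = 1 := by
      have := congrArg Subtype.val hc₁; simpa using this
    have hc₂' : c₂ • (w : ResidueField S) = residue S (e r₁) := by
      have := congrArg Subtype.val hc₂; simpa using this
    apply hd₁out
    refine ⟨c₂ * c₁⁻¹, ?_⟩
    rw [← halg, map_mul, map_inv₀, ← hc₂', Algebra.smul_def]
    congr 1
    rw [Algebra.smul_def] at hc₁'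
    exact (eq_inv_of_mul_eq_one_right hc₁').symm
  -- rank–nullity: `finrank (ker φ) ≤ 1`
  have hrn := LinearMap.finrank_range_add_finrank_ker φ
  rw [Module.finrank_fin_fun] at hrn
  have hker : Module.finrank (ResidueField R) (LinearMap.ker φ) ≤ 1 := by omega
  obtain ⟨v₀, hv₀⟩ := finrank_le_one_iff.mp hker
  -- lift the spanning vector of `ker φ` to `r₀ = Σ aᵢ xᵢ`
  have hlift : ∀ i, ∃ a : R, residue R a = (v₀ : Fin 3 → ResidueField R) i := fun i =>
    Ideal.Quotient.mk_surjective _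
  choose a ha using hlift
  have hav₀ : (fun i => residue R (a i)) = (v₀ : Fin 3 → ResidueField R) := funext ha
  set r₀ : R := ∑ i, a i * x i with hr₀def
  have hr₀m : r₀ ∈ maximalIdeal R := hlin a
  have her₀ : residue S (e r₀) = 0 := by
    rw [hr₀def, hcompat, hav₀]
    exact LinearMap.mem_ker.mp v₀.2
  have hr₀W : ∃ s ∈ maximalIdeal S, ι r₀ = s * ι t :=
    ⟨e r₀, (residue_eq_zero_iff _).mp her₀, (he r₀ hr₀m).symm⟩
  refine hasNormalSylow_of_pointBlowupStep_of_rank_le_one p ι hι t ht hgen τ τ₁ hτ hcomp hres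
    r₀ hr₀m hr₀W fun r hr hrW => ?_
  -- `r ∈ W̃`: its coefficient vector lies in `ker φ`, hence is `c • v₀` mod `𝔪`
  obtain ⟨s, hs, hrs⟩ := hrW
  obtain ⟨b, hb⟩ := hrepr r hr
  have hers : e r = s := huniq r hr s hrs.symm
  have hbker : (fun i => residue R (b i)) ∈ LinearMap.ker φ := by
    rw [LinearMap.mem_ker, ← hcompat, hb, hers]
    exact (residue_eq_zero_iff _).mpr hs
  obtain ⟨c, hc⟩ := hv₀ ⟨_, hbker⟩
  obtain ⟨c', hc'⟩ : ∃ c' : R, residue R c' = c := Ideal.Quotient.mk_surjective c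
  have hcoef : ∀ i, b i - c' * a i ∈ maximalIdeal R := by
    intro i
    have hci : c * (v₀ : Fin 3 → ResidueField R) i = residue R (b i) := by
      have := congrArg (fun w : (Fin 3 → ResidueField R) => w i) (congrArg Subtype.val hc)
      simpa using this
    rw [← residue_eq_zero_iff, map_sub, map_mul, hc', ha i, hci, sub_self]
  refine ⟨c', ?_⟩
  have key : r - c' * r₀ = ∑ i, (b i - c' * a i) * x i := by
    rw [← hb, hr₀def, Finset.mul_sum, ← Finset.sum_sub_distrib]
    refine Finset.sum_congr rfl fun i _ => ?_
    ring
  rw [key, pow_two]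
  exact Ideal.sum_mem _ fun i _ => Ideal.mul_mem_mul (hcoef i) (hxm i)

end Summit.ResolutionOfSingularities.ResolutionOfSingularities.Theorems.WildQuotientResolution.PointBlowupResidue
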